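import Literature.AlgebraicGeometry.HodgeTheory.ProjectiveBundleTautologicalQuotientReduction
import HarnessLib

/-!
# The projective bundle of a GLOBALLY GENERATED vector bundle, with its tautological quotient (named fact)

Family `hodge`, layer `Literature/AlgebraicGeometry/HodgeTheory`. ONE named fact (a `def … : Prop`, never
asserted); statement only, no instance, no notation, no `sorry`.

THE NAMED FACT `ProjectiveBundleOfGloballyGeneratedQuotient` — Hartshorne II Prop. 7.10/7.11 for a GLOBALLY
GENERATED locally free sheaf of CONSTANT rank: for a smooth projective complex variety `X` of dimension `n`, a
finite `J` and an epimorphism `φ : 𝒪_X^J ↠ G` with `G` of rank `r + 1`, there are a smooth projective complex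
variety `P` of dimension `n + r`, a SURJECTIVE `p : P ⟶ X` and a short exact sequence `0 → K → p^*G → L → 0`
with `rank K = r`, `rank L = 1`. In print: `P = 𝐏(G) → X` is a `ℙʳ`-bundle, smooth projective of dimension
`dim X + r` and surjective (Prop. 7.10), with the natural surjection `π^*G ↠ 𝒪(1)` (Prop. 7.11 (b)) whose kernel
is locally free of rank `r` (Fulton B.5.5); for `G` a quotient of `𝒪_X^J`, `𝐏(G)` is the closed incidence
subscheme of `𝐏(𝒪_X^J) = X × ℙ(J)` (Prop. 7.12) — the road of the intended proof over the tree's Grassmannian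
`grassmannianScheme (J → ℤ) 1` and `Modules/VanishingLocusOfHom` (scoping memo `CENSUS-K1-hand-19780-g4.md`,
stubs F1–F3), NOT carried out here.

WHY. By the PROVED reduction `HodgeTheory/ProjectiveBundleTautologicalQuotientReduction`
(`projectiveBundleTautologicalQuotient_of_forall_globallyGenerated`: constant rank on the irreducible `X`,
Serre's theorem A `𝒪_X(-m)^{⊞(N+1)} ↠ F`, and the twist `P(F) = P(F ⊗ 𝒪_X(m))`, Hartshorne II Lemma 7.9 (b)),
this fact IMPLIES the tree's `ProjectiveBundleTautologicalQuotient` (one level of P(E) for EVERY vector bundle),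
hence `FlagBundleSplitting ⟺ SplittingPrincipleBetti` and the cycle law for the analytified Chern character
(`Summits/HodgeConjecture/…/EightfoldBlochSeedsChernCharacterOnBettiAnalytificationFlagBundle`) — the one-line
corollary `projectiveBundleTautologicalQuotient_of_forall_globallyGenerated h` is recorded in the sequel
`HodgeTheory/ProjectiveBundleTautologicalQuotientOfGloballyGenerated`. HONEST LEDGER: a named fact is a hypothesis,
not a theorem; net effect on the debt chain: the ONE remaining construction is now «P(G) for G globally
generated» (no Serre theorem, no twisting inside). Nothing here bears on any case of the Hodge conjecture.

## References

* [Hartshorne1977] R. Hartshorne, *Algebraic Geometry* (1977), II §7 Prop. 7.10, Prop. 7.11 (b), Prop. 7.12,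
  Lemma 7.9 (p. 160–162).
* [Fulton1998] W. Fulton, *Intersection Theory*, 2nd ed. (1998), §3.1, §3.2, Appendix B.5.5.
* [Grothendieck1958] A. Grothendieck, *La théorie des classes de Chern*, Bull. SMF 86 (1958), §2.
-/

noncomputable section

open CategoryTheory CategoryTheory.Limits AlgebraicGeometry
open Literature.AlgebraicGeometry.Motives Literature.AlgebraicGeometry.Modules

namespace Literature.AlgebraicGeometry.HodgeTheory

/-- **The projective bundle of a GLOBALLY GENERATED vector bundle, with its tautological quotient**
(named fact; the globally generated, constant-rank form of Hartshorne II Prop. 7.10/7.11). For a smooth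
projective complex variety `X` of dimension `n`, a finite index type `J` and an epimorphism
`φ : 𝒪_X^J ↠ G` onto a module of constant rank `r + 1`, there are a smooth projective complex variety `P`
OF DIMENSION `n + r`, a SURJECTIVE morphism `p : P ⟶ X` and a short exact sequence `0 → K → p^*G → L → 0`
of `𝒪_P`-modules with `K` of rank `r` and `L` of rank `1` (middle term identified with `p^*G` by an
isomorphism). In print: `P = 𝐏(G) = 𝐏𝐫𝐨𝐣(Sym G)`, a `ℙʳ`-bundle over `X` (Prop. 7.10: smooth projective,
`dim P = dim X + r`, `π` surjective), with «a natural surjective morphism `π^*G → 𝒪(1)`» (Prop. 7.11 (b))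
whose kernel is locally free of rank `r` (the tautological sequence, Fulton B.5.5); for `G` globally
generated by `𝒪_X^J ↠ G`, `𝐏(G)` is the closed incidence subscheme of `X × ℙ(J)` (Prop. 7.12). Recorded here
is exactly this consequence, in the tree's vocabulary (`IsSmoothProjective`, Mathlib `Surjective`,
`Scheme.Modules.pullback`, `ShortComplex.ShortExact`, `Motives.HasRank`, Mathlib `SheafOfModules.free`).
[cite: Hartshorne1977, II §7 Prop. 7.10, Prop. 7.11 (b), Prop. 7.12 (the projective space bundle P(E))]
[cite: Fulton1998, §3.1, §3.2 and Appendix B.5.5 (tautological exact sequence on P(E))]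
[cite: Grothendieck1958, §2 (principe de scindage)] -/
def ProjectiveBundleOfGloballyGeneratedQuotient : Prop :=
  ∀ (n : ℕ) (X : SchemeOver ℂ), IsSmoothProjective n X →
    ∀ (J : Type) [Finite J] (G : X.left.Modules) (r : ℕ)
      (φ : (SheafOfModules.free J : X.left.Modules) ⟶ G), Epi φ → HasRank G (r + 1) →
      ∃ (P : SchemeOver ℂ) (p : P ⟶ X), IsSmoothProjective (n + r) P ∧ Surjective p.left ∧
        ∃ S : ShortComplex P.left.Modules, S.ShortExact ∧ HasRank S.X₁ r ∧ HasRank S.X₃ 1 ∧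
          Nonempty (S.X₂ ≅ (Scheme.Modules.pullback p.left).obj G)

end Literature.AlgebraicGeometry.HodgeTheory

end
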